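import Literature.NumberTheory.EllipticCurves.ProfiniteGroupDistributionRing

/-!
# STUB-IDEAS k3 (gen 24) — «(2)₂, CUT»: the out-of-range logarithm law of road RT,
# decomposed into PRINT ∧ local S–M ∧ dictionary, with the glue kernel-checked
# on the tree's Galois-side measure currency `GroupDistribution`

Seat `sidea-stub_heegnerIndexLowerAtTwo-3-g24` (planner, stub-ideation, technique = decomposition with
a provable glue) on crux `stmt-BirchSwinnertonDyer-27851`
(`PrintCf2.SplitBadTwoLowerHalfOfFacts`), stub `stub_heegnerIndexLowerAtTwo` (LEAD skeleton v3,
sha16 `f2bd84c029a8a938`).  **BSD is NOT proved by anything in this file; the crux and the stub are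
NOT proved here.**  This file is Mathlib + tree only: it imports the tree's profinite-group measure
currency (`SubgroupTower`, `GroupDistribution`, `riemannSum`, `integral`,
`tendsto_riemannSum_integral`, `dirac`, `smul`) — the currency of `DeShalit1987.IsLMeasure` /
`DeShalit1987.thmII414_exists_lMeasure` (de Shalit II.4.14 in measure currency, stated for EVERY
prime `p`, so at `p = 2`) — contains no `sorry`, no new axiom, no `instance`, no notation, and touches
no `Theorems/` file.

## What is cut

Node **(2)₂** of the critic's road RT (STUB-PLAN v4.7 §4 ROAD RT STATUS; the WELCOME list of K21):
the OUT-OF-RANGE explicit reciprocity for the frame's elliptic-unit class at the Rubin point,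
`log_ω(loc_v κ_W) = E₂(key) · val · Ω_v` (k1-g16's shape `λ·log_ω y_K = E₂·val·Ω_p`) — Rubin 1992's
`log_{A,p}(κ_A) = (1 − β_p⁻¹)⁻¹ · L_p(ν_A^*) · Ω_p(A)` (BDP 2012, display (2)) transported to the
additive CM members `W = 49a^{(d)}`, `d ≢ 1 (4)`, at the split prime `2 = v v̄` of `K₀ = ℚ(√−7)`, in
LEAD's crossed-carrier labels (B19 (i)): `v̄` = the formal prime of `W[v̄^∞]`, infinitely ramified in
the twisting tower `𝓕_∞ = K₀(𝔤 v^e v̄^∞) ⊇ K₀(W[v̄^∞])`; `v` = the conjugate prime, of FINITE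
ramification (conductor exponent `e ∈ {2,3}` of `χ_d` at 2) in `𝓕_∞`; units and logarithms are taken
AT `v`; the measure is the CONJUGATE (`v`-adic) de Shalit measure `μ^{(v)}(𝔤 v̄^∞)`
(`thmII414_exists_lMeasure` at `p = 2`, `S = supp 𝔤`, embedding through `v`), twisted à la II.4.12
by an auxiliary `𝔞` (`GroupDistribution.twisting σ_𝔞 (N𝔞)`) and pushed forward
(`GroupDistribution.pushforward`) to `𝒢' = Gal(𝓕_∞/K₀)`, where EVERY character is out of range.

## The atoms (M1, M3 and the R130 declaration are typed here; M4 is words on the card)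

* **M1 `KLFMasses` (PRINT at p = 2).**  de Shalit II.5.2 (3)–(4) (the `p`-adic Kronecker limit
  formula for `μ_𝔞`: `p` split, ANY `p`, level `𝔤 = 𝔣𝔭ⁿ` with `𝔣` arbitrary — so divisible by `v̄^N`)
  + finite Fourier inversion on `Cl(𝔤 v^e v̄^N)` (Mathlib `AddChar.sum_apply_eq_ite` /
  `DirichletCharacter.sum_char_inv_mul_char_eq` shape): the level-`N` coset masses of the pushed
  forward twisted measure ARE the `v`-adic logarithms of the Galois conjugates of ONE fixed,
  level-independent `v^e`-RESOLVENT `ẽ_N` of the norm-coherent elliptic units `e_N(𝔞)` (the `v`-part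
  of the characters — Gauss sum `τ(χ_v⁻¹)` and `(1 − χ⁻¹(v)/2)` — is absorbed into the resolvent; no
  level-dependent constant survives: `c_KLF = 1`).
* **M3a `unitLogDistribution` (PROVED here).**  Norm-coherence of the units up the `v̄`-tower IS the
  distribution relation of their conjugate-log masses: together with boundedness of logarithms of
  units they form a `GroupDistribution` on the SAME tower — the «Coleman map in the direction
  unramified at v» needs no construction at `k = 0`.
* **M3 `TwistedKummerLogLaw` (local at `v`, S–M, V-level hence blind to `W(ℚ)[2] = ℤ/2`).**  For
  `V = ℚ₂(1) ⊗ ρ_v`, `ρ_v = ρ^{ur} · χ_d` (unramified of infinite order times the ramified quadratic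
  `χ_d`) over `ℚ₂ = K₀,v`: the Bloch–Kato logarithm of the `ρ`-twisted corestricted Kummer class of
  the norm-coherent unit family equals (period of `ρ_v`)⁻¹ `= E · Ω_v` times `∫ ρ dμ_e`.  Ingredients:
  Bloch–Kato 1990 Ex. 3.10.1 (`log_BK ∘ Kummer = log` on units), functoriality of `D_dR` under
  corestriction/twist, and the limit over the tower (the twisted sums CONVERGE by M3a + the tree's
  `tendsto_riemannSum_integral`).  NO Wiles/Coates–Wiles explicit reciprocity law: out of range at
  `k = 0` Coleman series are EVALUATED at torsion points (values = the units), never differentiated.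
* **R130 declaration `val_def` (σ⁻).**  `val := ∫_{𝒢'} ρ dμ_𝔞^{(v)}` — de Shalit's (49), a
  definition valid at every character of `𝒢`, in or out of range; the measure is unique by the tree's
  `LMeasureAvatarRigidity`, so `val` is a NUMBER, not an ∃-witness.
* **M4 (dictionary, S; card).**  `κ_W ∈ H¹(K₀, V_v W) = H¹(ℚ, V₂ W)` (Shapiro) IS road RT's bottom
  class (`= λ · κ(y_K)`, k1-g16); `log_ω = Ω_v · log_{𝔾̂_m} ∘ θ⁻¹` at `v` (de Shalit II.4.3–4.4).

## The glue (PROVED here)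

`val_tendsto_twistedUnitLogSums` — the value side IS «the ψ̂*-twisted limit up the tower» of unit
logarithms; `val_eq_mul_unitLogIntegral`; `outOfRangeLogLaw_of_atoms` — M1 ∧ M3 ∧ `c_KLF ≠ 0` ⟹
(2)₂ with `E₂ = E / c_KLF`; `norm_logLoc_eq`, `norm_lambda_mul_norm_logy_eq`, `val_ne_zero_iff` —
the valuation / non-vanishing shadows road RT consumes; `integral_eq_mul_of_masses` — two
distributions with proportional masses have proportional integrals; a Dirac model on the trivial
tower over `ℚ_[2]` shows the receptacle is inhabited and the glue fires (B32-style inhabitability).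
-/

set_option linter.dupNamespace false

noncomputable section

open scoped Classical
open Filter Topology
open Literature.NumberTheory.EllipticCurves

namespace Summit.BirchSwinnertonDyer.BirchSwinnertonDyer.Cruxes.SplitBadTwoLowerHalfOfFacts.OutOfRangeLogCutK3G24

/-! ## §0  Atom M3a — norm-coherence is the distribution relation of conjugate-log masses -/

section NormCoherence

variable {Γ : Type*} [Group Γ] {M : Type*} [AddCommGroup M] [DistribMulAction Γ M]
variable {A : Type*} [AddCommMonoid A]

/-- **M3a, algebraic core (PROVED).**  `Γ` acts on the (additively written) unit group `M`; `H ⊆ Γ` a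
finite set (representatives of `Gal(𝓕_{n+1}/𝓕_n)`); `u₁` the level-`(n+1)` unit and
`u₀ = ∑_{h ∈ H} h • u₁` its norm; `ℓ : M →+ A` ANY additive map (the `v`-adic logarithm through a
FIXED embedding `𝓕_∞ ↪ K₀,v^{alg}` — no Galois-equivariance needed).  Then the level-`(n+1)` masses
over the fibre `γH` sum to the level-`n` mass. [this file] -/
theorem mass_sum_kernel_eq (ℓ : M →+ A) (H : Finset Γ) (γ : Γ) (u₁ u₀ : M)
    (hnorm : ∑ h ∈ H, h • u₁ = u₀) :
    ∑ h ∈ H, ℓ ((γ * h) • u₁) = ℓ (γ • u₀) := by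
  rw [← hnorm, Finset.smul_sum, map_sum]
  exact Finset.sum_congr rfl fun h _ => by rw [mul_smul]

end NormCoherence

section UnitLogDistribution

variable {G : Type*} [Group G] (𝒰 : SubgroupTower G)
variable {M : Type*} [AddCommGroup M] [DistribMulAction G M]
variable {𝕜 : Type*} [NormedField 𝕜]

/-- **M3a (PROVED): the conjugate-log distribution of a norm-coherent unit family EXISTS on the tree's
currency.**  `G = Γ_{K₀}` with the tower `𝒰` (`U n = Gal(K̄/𝓕_n)`), `u n ∈ M` the level-`n` unit
(resolvent), `ℓ : M →+ 𝕜` the `v`-adic logarithm through a fixed embedding.  Hypotheses: `hnorm` =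
norm-coherence in coset form (`∑_{σ'U_{n+1} ⊆ σU_n} σ' • u_{n+1} = σ • u_n`, i.e.
`σ ∘ N_{𝓕_{n+1}/𝓕_n} (u_{n+1}) = σ u_n` read on a system of coset representatives) and `hC` =
boundedness of logarithms of units.  Output: the `GroupDistribution` `μ_e(n, σU_n) = ℓ(σ̃ • u_n)`.
[this file] -/
def unitLogDistribution (ℓ : M →+ 𝕜) (u : ℕ → M)
    (hnorm : ∀ (n : ℕ) (a : G ⧸ 𝒰.U n),
      ∑ b ∈ (𝒰.cells (n + 1)).filter (fun b => 𝒰.trans n b = a), 𝒰.repr (n + 1) b • u (n + 1)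
        = 𝒰.repr n a • u n)
    {C : ℝ} (hC0 : 0 ≤ C) (hC : ∀ (n : ℕ) (σ : G), ‖ℓ (σ • u n)‖ ≤ C) : GroupDistribution 𝒰 𝕜 where
  μ n a := ℓ (𝒰.repr n a • u n)
  sum_fiber n a := by rw [← map_sum, hnorm n a]
  bound := C
  bound_nonneg := hC0
  norm_le n a := hC n (𝒰.repr n a)

/-- The level masses of the unit-log distribution. [this file] -/
@[simp] theorem unitLogDistribution_μ (ℓ : M →+ 𝕜) (u : ℕ → M) (hnorm) {C : ℝ} (hC0 : 0 ≤ C) (hC)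
    (n : ℕ) (a : G ⧸ 𝒰.U n) :
    (unitLogDistribution 𝒰 ℓ u hnorm hC0 hC).μ n a = ℓ (𝒰.repr n a • u n) := rfl

end UnitLogDistribution

/-! ## §1  Two distributions with proportional masses -/

section Proportional

variable {G : Type*} [Group G] {𝒰 : SubgroupTower G}
variable {𝕜 : Type*} [NormedField 𝕜]

/-- Proportional level masses give proportional Riemann sums (no analysis). [this file] -/
theorem riemannSum_eq_mul_of_masses (D₁ D₂ : GroupDistribution 𝒰 𝕜) (c : 𝕜)
    (h : ∀ (n : ℕ) (a : G ⧸ 𝒰.U n), D₁.μ n a = c * D₂.μ n a) (f : G → 𝕜) (n : ℕ) :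
    D₁.riemannSum f n = c * D₂.riemannSum f n := by
  simp only [GroupDistribution.riemannSum_def, h, Finset.mul_sum, mul_assoc]

variable [IsUltrametricDist 𝕜] [CompleteSpace 𝕜]

/-- **Proportional masses ⟹ proportional integrals** (tower-continuous integrand, complete
non-archimedean field): the tree's `tendsto_riemannSum_integral` twice and uniqueness of limits.
[this file] -/
theorem integral_eq_mul_of_masses (D₁ D₂ : GroupDistribution 𝒰 𝕜) (c : 𝕜)
    (h : ∀ (n : ℕ) (a : G ⧸ 𝒰.U n), D₁.μ n a = c * D₂.μ n a) {f : G → 𝕜}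
    (hf : 𝒰.IsTowerContinuous f) : D₁.integral f = c * D₂.integral f := by
  have h₁ := D₁.tendsto_riemannSum_integral hf
  have h₂ : Tendsto (D₁.riemannSum f) atTop (𝓝 (c * D₂.integral f)) :=
    ((D₂.tendsto_riemannSum_integral hf).const_mul c).congr'
      (Eventually.of_forall fun n => (riemannSum_eq_mul_of_masses D₁ D₂ c h f n).symm)
  exact tendsto_nhds_unique h₁ h₂

/-- **The twisted limit, literally**: with proportional masses the level sums
`∑_a c · μ₂(n,a) · f(σ̃_a)` converge to `∫ f dμ₁`. [this file] -/
theorem tendsto_mul_sums_integral (D₁ D₂ : GroupDistribution 𝒰 𝕜) (c : 𝕜)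
    (h : ∀ (n : ℕ) (a : G ⧸ 𝒰.U n), D₁.μ n a = c * D₂.μ n a) {f : G → 𝕜}
    (hf : 𝒰.IsTowerContinuous f) :
    Tendsto (fun n => ∑ a ∈ 𝒰.cells n, c * D₂.μ n a * f (𝒰.repr n a)) atTop
      (𝓝 (D₁.integral f)) := by
  refine (D₁.tendsto_riemannSum_integral hf).congr' (Eventually.of_forall fun n => ?_)
  simp only [GroupDistribution.riemannSum_def, h]

end Proportional

/-! ## §2  The frame of node (2)₂, its atoms, and the glue -/

section OutOfRangeLogCut

variable {G : Type*} [Group G] (𝒰 : SubgroupTower G)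
variable (𝕜 : Type*) [NormedField 𝕜]

/-- **FRAME of node (2)₂** (LEAD labels, B19 (i)).  `G = Γ_{K₀}` with the ray-class tower `𝒰` of
`𝓕_n = K₀(𝔤 v^e v̄^n)` (`DeShalit1987.rayClassTower`-shape), `𝕜 ⊇ ℚ₂(values of ψ_W, 𝒟)` complete
non-archimedean (e.g. `ℂ_[2]`).
* `katz` — the twisted CONJUGATE de Shalit measure `12(σ_𝔞 − N𝔞)·μ^{(v)}(𝔤 v̄^∞)` read on `𝒢'`
  (`thmII414_exists_lMeasure` at `p = 2` + `GroupDistribution.twisting` + `pushforward`);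
* `unitLog` — the conjugate-log distribution of the `v^e`-resolvents of the elliptic units `e_n(𝔞)`
  (`unitLogDistribution`, M3a);
* `ρ` — the twisting character `(ψ_W^*)_{(v)}⁻¹` on `G` (tower-continuous: constant mod `2^n` on
  `U_n`-cosets);
* `val`, `val_def` — the **R130 declaration** (σ⁻): `val := ∫ ρ d katz` (de Shalit (49));
* `logLoc` — `log_ω(loc_v κ_W)`; `Ω`, `norm_Ω` — the `v`-adic period `Ω_v ∈ 𝒟ˣ` (II.4.4). [this file] -/
structure OutOfRangeFrame where
  /-- level masses of the twisted, pushed-forward conjugate de Shalit measure -/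
  katz : GroupDistribution 𝒰 𝕜
  /-- level masses `log_v(σ̃ ẽ_n)` of the resolvents of the norm-coherent elliptic units -/
  unitLog : GroupDistribution 𝒰 𝕜
  /-- the twisting character `ρ = (ψ_W^*)_{(v)}⁻¹` -/
  ρ : G → 𝕜
  /-- `ρ` is tower-continuous -/
  ρ_cont : 𝒰.IsTowerContinuous ρ
  /-- the out-of-range value (R130: σ⁻) -/
  val : 𝕜
  /-- R130 declaration: `val = ∫ ρ d katz` -/
  val_def : val = katz.integral ρ
  /-- `log_ω (loc_v κ_W)` -/
  logLoc : 𝕜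
  /-- the `v`-adic period `Ω_v` -/
  Ω : 𝕜
  /-- `Ω_v` is a unit -/
  norm_Ω : ‖Ω‖ = 1

variable {𝒰 𝕜}

/-- **ATOM M1 `KLFMasses` (PRINT at p = 2: de Shalit II.5.2 (3)–(4) + II.4.12/4.14 + finite Fourier
inversion).**  The level masses of `katz` are `c_KLF` times those of `unitLog`, ONE booked constant.
Why it might fail: a level-dependent renormalisation hiding in the `2^{m₀}` of p. 73 at `p = 2`, or
the `v`-unramified characters' Euler factors not absorbable into a level-independent resolvent.
[this file] -/
def KLFMasses (F : OutOfRangeFrame 𝒰 𝕜) (cKLF : 𝕜) : Prop :=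
  ∀ (n : ℕ) (a : G ⧸ 𝒰.U n), F.katz.μ n a = cKLF * F.unitLog.μ n a

/-- **ATOM M3 `TwistedKummerLogLaw` (local at `v`, S–M, V-level).**
`log_ω(loc_v κ_W) = E · Ω_v · ∫ ρ dμ_e`, `E` ONE booked local constant (period/Gauss digit of the
ramified quadratic part `χ_d` of `ρ_v`, corestriction index).  Why it might fail: the period of
`ρ_v = ρ^{ur}·χ_d` mis-booked (half-integral valuation `e/2`), or the twist direction (`ρ` vs `ρ⁻¹`).
[this file] -/
def TwistedKummerLogLaw (F : OutOfRangeFrame 𝒰 𝕜) (E : 𝕜) : Prop :=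
  F.logLoc = E * F.Ω * F.unitLog.integral F.ρ

/-- **NODE (2)₂** in k1-g16's shape: `log_ω(loc_v κ_W) = E₂ · val · Ω_v`. [this file] -/
def OutOfRangeLogLaw (F : OutOfRangeFrame 𝒰 𝕜) (E₂ : 𝕜) : Prop :=
  F.logLoc = E₂ * F.val * F.Ω

/-- **ATOM M1′ `KLFValue` (the INTEGRAL-level form of M1 — what the glue really consumes).**
`val = c_KLF · ∫ ρ dμ_e` with `c_KLF = τ(χ̄_{d,v})` the Gauss sum of the `v`-component of `ρ`
(conductor `2^e`, `v₂(c_KLF) = e/2`): M1 for the `v^e`-RESOLVENT family, followed by character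
orthogonality on `(𝒪/v^e)ˣ` (only the `η = χ_{d,v}`-component of the resolvent survives integration
against `ρ`; tree `GroupDistribution.integral_conv_dirac` for the translations, Mathlib
`AddChar.sum_apply_eq_ite`-shape orthogonality).  `KLFMasses → KLFValue` is PROVED below; a stub prover
may discharge M1 at either level. [this file] -/
def KLFValue (F : OutOfRangeFrame 𝒰 𝕜) (cKLF : 𝕜) : Prop :=
  F.val = cKLF * F.unitLog.integral F.ρ

variable [IsUltrametricDist 𝕜] [CompleteSpace 𝕜]

/-- **VALUE SIDE = the ψ̂*-twisted limit up the tower (PROVED from M1 + the tree).** [this file] -/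
theorem val_tendsto_twistedUnitLogSums (F : OutOfRangeFrame 𝒰 𝕜) {cKLF : 𝕜}
    (hM1 : KLFMasses F cKLF) :
    Tendsto (fun n => ∑ a ∈ 𝒰.cells n, cKLF * F.unitLog.μ n a * F.ρ (𝒰.repr n a)) atTop
      (𝓝 F.val) := by
  rw [F.val_def]
  exact tendsto_mul_sums_integral F.katz F.unitLog cKLF hM1 F.ρ_cont

/-- **VALUE SIDE, closed form (PROVED):** `val = c_KLF · ∫ ρ dμ_e`. [this file] -/
theorem val_eq_mul_unitLogIntegral (F : OutOfRangeFrame 𝒰 𝕜) {cKLF : 𝕜}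
    (hM1 : KLFMasses F cKLF) : F.val = cKLF * F.unitLog.integral F.ρ := by
  rw [F.val_def]
  exact integral_eq_mul_of_masses F.katz F.unitLog cKLF hM1 F.ρ_cont

/-- `KLFMasses ⟹ KLFValue` (PROVED). [this file] -/
theorem klfValue_of_klfMasses (F : OutOfRangeFrame 𝒰 𝕜) {cKLF : 𝕜} (hM1 : KLFMasses F cKLF) :
    KLFValue F cKLF :=
  val_eq_mul_unitLogIntegral F hM1

omit [IsUltrametricDist 𝕜] [CompleteSpace 𝕜] in
/-- **THE GLUE at integral level (PROVED): M1′ ∧ M3 ∧ `c_KLF ≠ 0` ⟹ (2)₂ with `E₂ = E / c_KLF`.**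
Both sides of (2)₂ are the SAME twisted limit of unit logarithms. [this file] -/
theorem outOfRangeLogLaw_of_klfValue (F : OutOfRangeFrame 𝒰 𝕜) {cKLF E : 𝕜}
    (hM1 : KLFValue F cKLF) (hM3 : TwistedKummerLogLaw F E) (hc : cKLF ≠ 0) :
    OutOfRangeLogLaw F (E / cKLF) := by
  have hint : F.unitLog.integral F.ρ = F.val / cKLF := by
    unfold KLFValue at hM1
    rw [hM1]; field_simp
  unfold OutOfRangeLogLaw
  rw [hM3, hint]
  field_simp

/-- **THE GLUE (PROVED): M1 ∧ M3 ∧ `c_KLF ≠ 0` ⟹ (2)₂ with `E₂ = E / c_KLF`.** [this file] -/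
theorem outOfRangeLogLaw_of_atoms (F : OutOfRangeFrame 𝒰 𝕜) {cKLF E : 𝕜}
    (hM1 : KLFMasses F cKLF) (hM3 : TwistedKummerLogLaw F E) (hc : cKLF ≠ 0) :
    OutOfRangeLogLaw F (E / cKLF) :=
  outOfRangeLogLaw_of_klfValue F (klfValue_of_klfMasses F hM1) hM3 hc

omit [IsUltrametricDist 𝕜] [CompleteSpace 𝕜] in
/-- **The (2)₂ digit in norm currency (PROVED):** `‖log_ω(loc_v κ_W)‖ = (‖E‖ / ‖c_KLF‖) · ‖val‖` — the
exponent `x₂` of k2-g24's product law is `2·v₂(c_KLF) − 2·v₂(E)` (sign per D3's convention).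
[this file] -/
theorem norm_logLoc_eq_of_atoms (F : OutOfRangeFrame 𝒰 𝕜) {cKLF E : 𝕜}
    (hM1 : KLFValue F cKLF) (hM3 : TwistedKummerLogLaw F E) (hc : cKLF ≠ 0) :
    ‖F.logLoc‖ = ‖E‖ / ‖cKLF‖ * ‖F.val‖ := by
  have h := outOfRangeLogLaw_of_klfValue F hM1 hM3 hc
  unfold OutOfRangeLogLaw at h
  rw [h, norm_mul, norm_mul, norm_div, F.norm_Ω, mul_one]

omit [IsUltrametricDist 𝕜] [CompleteSpace 𝕜] in
/-- **Valuation shadow of (2)₂ (PROVED):** `‖log_ω(loc_v κ_W)‖ = ‖E₂‖ · ‖val‖`. [this file] -/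
theorem norm_logLoc_eq (F : OutOfRangeFrame 𝒰 𝕜) {E₂ : 𝕜} (h : OutOfRangeLogLaw F E₂) :
    ‖F.logLoc‖ = ‖E₂‖ * ‖F.val‖ := by
  unfold OutOfRangeLogLaw at h
  rw [h, norm_mul, norm_mul, F.norm_Ω, mul_one]

omit [IsUltrametricDist 𝕜] [CompleteSpace 𝕜] in
/-- **Road RT's consumption (PROVED):** with k1-g16's colinearity read through `log_ω ∘ loc_v`
(`logLoc = λ · log_ω y_K`), (2)₂ gives `‖λ‖ · ‖log_ω y_K‖ = ‖E₂‖ · ‖val‖`. [this file] -/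
theorem norm_lambda_mul_norm_logy_eq (F : OutOfRangeFrame 𝒰 𝕜) {E₂ lam logy : 𝕜}
    (h : OutOfRangeLogLaw F E₂) (hcol : F.logLoc = lam * logy) :
    ‖lam‖ * ‖logy‖ = ‖E₂‖ * ‖F.val‖ := by
  rw [← norm_mul, ← hcol]
  exact norm_logLoc_eq F h

omit [IsUltrametricDist 𝕜] [CompleteSpace 𝕜] in
/-- **Non-vanishing transfer (PROVED):** under (2)₂ with `E₂ ≠ 0`, `val ≠ 0 ↔ log_ω(loc_v κ_W) ≠ 0`.
[this file] -/
theorem val_ne_zero_iff (F : OutOfRangeFrame 𝒰 𝕜) {E₂ : 𝕜} (h : OutOfRangeLogLaw F E₂)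
    (hE : E₂ ≠ 0) : F.val ≠ 0 ↔ F.logLoc ≠ 0 := by
  have hΩ : F.Ω ≠ 0 := fun h0 => by simpa [h0] using F.norm_Ω
  unfold OutOfRangeLogLaw at h
  rw [h]
  constructor
  · intro hv; exact mul_ne_zero (mul_ne_zero hE hv) hΩ
  · intro hl hv; exact hl (by rw [hv, mul_zero, zero_mul])

end OutOfRangeLogCut

/-! ## §2b  The conductor–discriminant cancellation behind the class-constancy of the (2)₂ digit -/

section Digit

/-- Conductor exponent at 2 of the quadratic character `χ_d`, `d ≢ 1 (4)` squarefree: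
`e(d) = 2` if `d ≡ 3 (4)`, `e(d) = 3` if `d ≡ 2 (4)`. [this file] -/
def twistCondExp (d : ℤ) : ℤ := if d % 4 = 3 then 2 else 3

/-- `v₂(d)` on the two classes: `0` if `d ≡ 3 (4)`, `1` if `d ≡ 2 (4)` (squarefree). [this file] -/
def discVal (d : ℤ) : ℤ := if d % 4 = 3 then 0 else 1

/-- **Class-constancy of the (2)₂ digit (PROVED bookkeeping).**  With `v₂(c_KLF) = e(d)/2` (Gauss sum
of conductor `2^{e(d)}`) and `v₂(E) = v₂(√d) + k = v₂(d)/2 + k` (`k` a universal convention digit of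
sub-stub B), `2·(v₂(E) − v₂(c_KLF)) − 2k = v₂(d) − e(d) = −2` on BOTH classes — the same
conductor–discriminant cancellation k2-g24 met in (3)₂ (`2^{−a(d)}/‖d‖₂ = 1/4`). [this file] -/
theorem digit_classConstant (d : ℤ) : discVal d - twistCondExp d = -2 := by
  unfold discVal twistCondExp
  split_ifs <;> norm_num

end Digit

/-! ## §3  A model inhabitant (receptacle inhabited, glue fires) -/

section Model

/-- The trivial tower on a group (every level `⊤`). [this file] -/
def trivialTower (G : Type*) [Group G] : SubgroupTower G where
  U _ := ⊤
  finiteIndex _ := inferInstance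
  succ_le _ := le_rfl

/-- The constant function `1` is tower-continuous on the model tower. [this file] -/
theorem model_const_cont :
    (trivialTower (Multiplicative ℤ)).IsTowerContinuous (fun _ : Multiplicative ℤ => (1 : ℚ_[2])) :=
  SubgroupTower.IsTowerContinuous.const (𝒰 := trivialTower (Multiplicative ℤ)) (1 : ℚ_[2])

/-- A MODEL frame over `ℚ_[2]`: both distributions Dirac at `1`, trivial character,
`val = logLoc = Ω = 1`. [this file] -/
def modelFrame : OutOfRangeFrame (trivialTower (Multiplicative ℤ)) ℚ_[2] where
  katz := GroupDistribution.dirac (trivialTower (Multiplicative ℤ)) (1 : Multiplicative ℤ)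
  unitLog := GroupDistribution.dirac (trivialTower (Multiplicative ℤ)) (1 : Multiplicative ℤ)
  ρ := fun _ => 1
  ρ_cont := model_const_cont
  val := 1
  val_def := (GroupDistribution.integral_dirac (1 : Multiplicative ℤ) model_const_cont).symm
  logLoc := 1
  Ω := 1
  norm_Ω := norm_one

/-- In the model, M1 holds with `c_KLF = 1`. [this file] -/
theorem modelFrame_M1 : KLFMasses modelFrame 1 := fun n a => by
  simp [modelFrame]

/-- In the model, M3 holds with `E = 1`. [this file] -/
theorem modelFrame_M3 : TwistedKummerLogLaw modelFrame 1 := by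
  unfold TwistedKummerLogLaw
  simp only [modelFrame, one_mul]
  exact (GroupDistribution.integral_dirac (1 : Multiplicative ℤ) model_const_cont).symm

/-- The glue fires on the model: (2)₂ holds there with `E₂ = 1 / 1`. [this file] -/
example : OutOfRangeLogLaw modelFrame (1 / 1) :=
  outOfRangeLogLaw_of_atoms modelFrame modelFrame_M1 modelFrame_M3 one_ne_zero

end Model

end Summit.BirchSwinnertonDyer.BirchSwinnertonDyer.Cruxes.SplitBadTwoLowerHalfOfFacts.OutOfRangeLogCutK3G24

end
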